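import Literature.AlgebraicGeometry.HodgeTheory.ComplexTorusIntegralHodgeClassesProductPushforward
import Literature.Geometry.Kaehler.ComplexTorusCorrespondenceComposition
import Literature.Geometry.Kaehler.ComplexTorusCorrespondencePullback
import HarnessLib

/-!
# The push-forward along a projection is integration along the fibre; base change along the base

For complex tori `X₁`, `X₂` and the projection `p₂ : X₁ × X₂ → X₂` we identify the push-forward of g27-#2
(`integralHodgeClassesPushforward`, `= D ∘ H_•(p₂) ∘ (− ∩ [X₁ × X₂])`) on integral Hodge classes with the fibre integral on invariant
forms (`pushforwardFst`, Layer A `ComplexTorusPushforward`), and deduce the base change formula along the base for ARBITRARY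
homomorphisms:

* **`coe_integralHodgeClassesPushforward_sndHom`** — Arapura's Lemma 5.5.1 / Birkenhake–Lange (6.10): the form of `p_{2*} w` is
  `∫_{X₁} w` (`pushforwardFst`), in the concatenated frame `e₁ ⊔ e₂`;
* **`integralHodgeClassesPushforward_sndHom_pullbackHom_prodMap_id`** — `p'_{2*}((1_{X₁} × f)^* w) = f^*(p_{2*} w)` for every
  `f : X₂′ → X₂` (Birkenhake–Lange Thm. 6.2.5, the case used in the proof of Lemma 6.2.8; Fulton Prop. 1.7);
* `pushforwardFst_compContinuousLinearMap_id_prodMap` — the form-level base change `∫_{X₁}(θ ∘ (1 × T)) = (∫_{X₁} θ) ∘ T` for a linear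
  map `T : E₂′ → E₂` (the tree's `pushforwardFst_compContinuousLinearMap_prodMap` is the endomorphism case);
* `cycleIntegral_fundamentalCycle_eq_torusIntegral` — `∫_{{X}_e} θ = ∫_X θ` for any index type.

Method (§1): the cycles `H(p₂)(w ∩ {X₁ × X₂})` and `(∫_{X₁} w) ∩ {X₂}` have the same periods — `∫_{u ∩ σ} φ = ∫_σ φ ∧ u`
(`cycleIntegral_capProduct'`), `∫_{H(f)σ} φ = ∫_σ f^*φ` (`cycleIntegral_homologyMap`), and Fubini
`∫_{X₂} (∫_{X₁} θ) ∧ ξ = ∫_{X₁ × X₂} θ ∧ p₂^*ξ` (`torusIntegral_pushforwardFst_wedge`) — so they are equal (`cycleIntegral_injective`), and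
`D_{X₂}` inverts `− ∩ [X₂]` (`poincareInverse_homologyCapMap_fundamentalClass`). Everything is proved; no named fact is introduced (D-0026).

## References

* [Arapura2012] D. Arapura, *Algebraic Geometry over the Complex Numbers*, Universitext (2012), §5.5.1 Lemma 5.5.1 (p0114 L1–L17).
* [Lange2023AbelianVarietiesComplex] H. Lange, *Abelian Varieties over the Complex Numbers*, Springer (2023), §6.2.1 Thm. 6.2.5 (p0302),
  §6.2.2 Lemma 6.2.8 (p0304 L1–L12), §6.2.4 (6.10) (p0310 L33–L35), §2.5.3 Cor. 2.5.17.
* [Fulton1998] W. Fulton, *Intersection Theory*, 2nd ed., Springer (1998), §1.7 Prop. 1.7 (p0030).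
* [VoisinHodgeI2002] C. Voisin, *Hodge Theory and Complex Algebraic Geometry I*, CUP (2002), §7.3.2 (p0151).
-/

noncomputable section

open CategoryTheory Function

namespace Literature.AlgebraicGeometry.HodgeTheory

open Literature.AlgebraicGeometry.Motives Literature.AlgebraicGeometry.Motives.HodgeStructure
open Literature.Geometry.Kaehler Literature.Geometry.Kaehler.ComplexTorus

/-! ## §0 Form-level bookkeeping -/

section Forms

variable {V : Type*} [NormedAddCommGroup V] [NormedSpace ℝ V]

/-- Reindexing the left factor of a wedge (bookkeeping). [folklore] -/
private theorem domDomCongr_finCongr_wedge₇ {k k' m : ℕ} (h : k = k') (η : V [⋀^Fin k]→L[ℝ] ℂ) (ψ : V [⋀^Fin m]→L[ℝ] ℂ) :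
    (η.domDomCongr (finCongr h)).wedge ψ = (η.wedge ψ).domDomCongr (finCongr (congrArg (· + m) h)) := by
  subst h; rfl

/-- Two successive reindexings (bookkeeping). [folklore] -/
private theorem domDomCongr_finCongr_domDomCongr_finCongr₇ {k k' k'' : ℕ} (h : k = k') (h' : k' = k'') (η : V [⋀^Fin k]→L[ℝ] ℂ) :
    (η.domDomCongr (finCongr h)).domDomCongr (finCongr h') = η.domDomCongr (finCongr (h.trans h')) := by
  subst h h'; rfl

/-- Graded commutativity with an even-degree factor: `δ ∧ γ = γ ∧ δ` up to reindexing. [folklore] -/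
private theorem wedge_comm_of_even_left₇ {p m : ℕ} (γ : V [⋀^Fin (2 * p)]→L[ℝ] ℂ) (δ : V [⋀^Fin m]→L[ℝ] ℂ) :
    δ.wedge γ = (γ.wedge δ).domDomCongr (finCongr (Nat.add_comm (2 * p) m)) := by
  rw [ContinuousAlternatingMap.WedgeComm_holds ℝ V ℂ γ δ, mul_assoc, pow_mul, neg_one_sq, one_pow, one_smul]

end Forms

section Torus

variable {ι₁ ι₂ ι₂' : Type*} [Fintype ι₁] [Fintype ι₂] [Fintype ι₂'] [DecidableEq ι₁] [DecidableEq ι₂] [DecidableEq ι₂'] {E₁ E₂ E₂' : Type*}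
  [NormedAddCommGroup E₁] [NormedSpace ℂ E₁] [NormedAddCommGroup E₂] [NormedSpace ℂ E₂] [NormedAddCommGroup E₂'] [NormedSpace ℂ E₂']
  (Φ₁ : (ι₁ → ℝ) ≃L[ℝ] E₁) (Φ₂ : (ι₂ → ℝ) ≃L[ℝ] E₂) (Φ₂' : (ι₂' → ℝ) ≃L[ℝ] E₂') {N₁ l : ℕ}

/-- Reindexing commutes with pull-back of forms (bookkeeping). [folklore] -/
private theorem domDomCongr_finCongr_compContinuousLinearMap₇ {V W : Type*} [NormedAddCommGroup V] [NormedSpace ℝ V] [NormedAddCommGroup W]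
    [NormedSpace ℝ W] {k k' : ℕ} (h : k = k') (η : V [⋀^Fin k]→L[ℝ] ℂ) (L : W →L[ℝ] V) :
    (η.compContinuousLinearMap L).domDomCongr (finCongr h) = (η.domDomCongr (finCongr h)).compContinuousLinearMap L := by
  subst h; rfl

/-- **Base change along the base for the fibre integral: `p'_{2*}((1 × T)^* θ) = T^*(p_{2*} θ)`** for a linear map `T : E₂′ → E₂` of the bases
(`1 × T` fixes the fibre frame `(λ_j, 0)`). The tree's `pushforwardFst_compContinuousLinearMap_prodMap` is the case `E₂′ = E₂`.
[cite: Lange2023AbelianVarietiesComplex, §6.2.1 Thm. 6.2.5 (base change, p0302)] [cite: Fulton1998, §1.7 Prop. 1.7 (p0030)] -/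
theorem pushforwardFst_compContinuousLinearMap_id_prodMap (e₁ : Fin N₁ ≃ ι₁) (θ : (E₁ × E₂) [⋀^Fin (N₁ + l)]→L[ℝ] ℂ) (T : E₂' →L[ℝ] E₂) :
    pushforwardFst Φ₁ Φ₂' e₁ (θ.compContinuousLinearMap ((ContinuousLinearMap.id ℝ E₁).prodMap T)) =
      (pushforwardFst Φ₁ Φ₂ e₁ θ).compContinuousLinearMap T := by
  ext w
  rw [ContinuousAlternatingMap.compContinuousLinearMap_apply, pushforwardFst_apply, pushforwardFst_apply,
    ContinuousAlternatingMap.compContinuousLinearMap_apply]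
  congr 2
  funext j
  refine Fin.addCases (fun i ↦ ?_) (fun i ↦ ?_) j
  · simp only [comp_apply, Fin.append_left]
    exact Prod.ext rfl (map_zero T)
  · simp only [comp_apply, Fin.append_right]
    rfl

omit [Fintype ι₂] in
/-- `∫` over a reindexed enumeration (bookkeeping). [folklore] -/
private theorem torusIntegral_domDomCongr_finCongr₇ {a b : ℕ} (h : a = b) (e' : Fin b ≃ ι₂) (θ : E₂ [⋀^Fin a]→L[ℝ] ℂ) :
    ComplexTorus.torusIntegral Φ₂ e' (θ.domDomCongr (finCongr h)) = ComplexTorus.torusIntegral Φ₂ ((finCongr h).trans e') θ := by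
  subst h; rfl

omit [Fintype ι₂] in
/-- `∫_{{X}_e} θ = ∫_X θ`: the period of a top form on the fundamental cycle is the torus integral (the tree's `cycleIntegral_fundamentalCycle` is the
case `ι = Fin n`). [cite: Lange2023AbelianVarietiesComplex, §2.5.3 Cor. 2.5.17 (a)] -/
theorem cycleIntegral_fundamentalCycle_eq_torusIntegral {N : ℕ} (e : Fin N ≃ ι₂) (θ : E₂ [⋀^Fin N]→L[ℝ] ℂ) :
    cycleIntegral Φ₂ N (ComplexTorus.fundamentalCycle Φ₂ e) θ = ComplexTorus.torusIntegral Φ₂ e θ := by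
  rw [fundamentalCycle_eq, map_zsmul, LinearMap.smul_apply, cycleIntegral_latCycle, ComplexTorus.torusIntegral, zsmul_eq_mul]
  rfl

end Torus

/-! ## §1 `p_{2*} = ∫_{X₁}` on integral Hodge classes -/

namespace ComplexTorusCat

section FibreIntegral

variable {X₁ X₂ : ComplexTorusCat} {g₁ n₂ g₂ G a a' l₀ : ℕ} (e₁ : Fin (2 * g₁) ≃ X₁.toIsog.ι) (e₂ : Fin n₂ ≃ X₂.toIsog.ι)
  (hX : l₀ + 2 * a = 2 * g₁ + n₂) (hG : G + G = 2 * g₁ + n₂) (hY : l₀ + 2 * a' = n₂) (hg₂ : g₂ + g₂ = n₂) (haa' : 2 * a = 2 * g₁ + 2 * a')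

/-- **THE PUSH-FORWARD ALONG THE PROJECTION `p₂ : X₁ × X₂ → X₂` IS INTEGRATION ALONG THE FIBRE** (Arapura, Lemma 5.5.1: "`p_! α` is represented by `∫_p α`";
Birkenhake–Lange §6.2.4 (6.10)): for `w ∈ Hdgᵃ(X₁ × X₂, ℤ)`, the form of `p_{2*} w ∈ Hdg^{a − g₁}(X₂, ℤ)` (the push-forward `D ∘ H_•(p₂) ∘ (− ∩ [X₁ × X₂])` of
g27-#2, in the concatenated frame `e₁ ⊔ e₂` and `e₂`) is the fibre integral `pushforwardFst` of the form of `w` (normalised by the complex orientation of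
the fibre). Proof: both have the same cap product with `{X₂}`, by the periods `∫_{u ∩ {X₂}} φ = ∫_{X₂} φ ∧ u`, `∫_{H(p₂)(w ∩ {T})} φ = ∫_T p₂^*φ ∧ w` and
Fubini `∫_{X₂} (∫_{X₁} θ) ∧ ξ = ∫_{X₁ × X₂} θ ∧ p₂^*ξ` (`torusIntegral_pushforwardFst_wedge`); and `D` inverts `− ∩ [X₂]`.
[cite: Arapura2012, §5.5.1 Lemma 5.5.1 (p0114 L1–L17)] [cite: Lange2023AbelianVarietiesComplex, §6.2.4 (6.10) (p0310 L33–L35)] [cite: VoisinHodgeI2002, §7.3.2 (p0151)] -/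
theorem coe_integralHodgeClassesPushforward_sndHom (w : integralHodgeClasses (prodObj X₁ X₂).toIsog.Φ a) :
    ((integralHodgeClassesPushforward a a' (sndHom X₁ X₂) (sumEnum e₁ e₂) e₂ hX hG hY hg₂ w : integralHodgeClasses X₂.toIsog.Φ a') :
        X₂.toIsog.E [⋀^Fin (2 * a')]→L[ℝ] ℂ) =
      pushforwardFst X₁.toIsog.Φ X₂.toIsog.Φ e₁
        ((w : (X₁.toIsog.E × X₂.toIsog.E) [⋀^Fin (2 * a)]→L[ℝ] ℂ).domDomCongr (finCongr haa')) := by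
  letI : LinearOrder X₁.toIsog.ι := LinearOrder.lift' (Fintype.equivFin X₁.toIsog.ι) (Fintype.equivFin X₁.toIsog.ι).injective
  letI : LinearOrder X₂.toIsog.ι := LinearOrder.lift' (Fintype.equivFin X₂.toIsog.ι) (Fintype.equivFin X₂.toIsog.ι).injective
  letI iT : LinearOrder (X₁.toIsog.ι ⊕ X₂.toIsog.ι) :=
    LinearOrder.lift' (Fintype.equivFin (X₁.toIsog.ι ⊕ X₂.toIsog.ι)) (Fintype.equivFin (X₁.toIsog.ι ⊕ X₂.toIsog.ι)).injective
  letI : LinearOrder (prodObj X₁ X₂).toIsog.ι := iT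
  have hwI : (w : (X₁.toIsog.E × X₂.toIsog.E) [⋀^Fin (2 * a)]→L[ℝ] ℂ) ∈ integralForms (prodObj X₁ X₂).toIsog.Φ (2 * a) :=
    ((mem_integralHodgeClassesIn_iff_mem_hodgeClassesIn (prodObj X₁ X₂).toIsog.Φ).1 w.2).2
  -- the candidate rational class `v = ∫_{X₁} w`
  set v : rationalForms X₂.toIsog.Φ (2 * a') := ⟨pushforwardFst X₁.toIsog.Φ X₂.toIsog.Φ e₁
      ((w : (X₁.toIsog.E × X₂.toIsog.E) [⋀^Fin (2 * a)]→L[ℝ] ℂ).domDomCongr (finCongr haa')),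
    pushforwardFst_mem_rationalForms X₁.toIsog.Φ X₂.toIsog.Φ e₁ (domDomCongr_finCongr_mem_rationalForms (prodPeriod X₁.toIsog.Φ X₂.toIsog.Φ) haa'
      (mem_rationalForms_of_mem_integralForms _ hwI))⟩ with hv
  have hvint : v ∈ integralKForms X₂.toIsog.Φ (2 * a') :=
    (mem_integralKForms_iff _ _).2 (pushforwardFst_mem_integralForms X₁.toIsog.Φ X₂.toIsog.Φ e₁
      (domDomCongr_finCongr_mem_integralForms (prodPeriod X₁.toIsog.Φ X₂.toIsog.Φ) haa' hwI))
  have hwint : (((intHodgeClassesAddEquivIntegralHodgeClasses (prodObj X₁ X₂) a).symm w : (HkIntObj (prodObj X₁ X₂) (2 * a)).intHodgeClasses a) :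
      rationalForms (prodObj X₁ X₂).toIsog.Φ (2 * a)) ∈ integralKForms (prodObj X₁ X₂).toIsog.Φ (2 * a) :=
    (mem_integralKForms_iff _ _).2 hwI
  -- the cycles `H(p₂)(w ∩ {T})` and `v ∩ {X₂}` have the same periods
  have hcyc : homologyMap (sndHom X₁ X₂).1 l₀
        (capProduct (prodObj X₁ X₂).toIsog.Φ hX
          ⟨((((intHodgeClassesAddEquivIntegralHodgeClasses (prodObj X₁ X₂) a).symm w : (HkIntObj (prodObj X₁ X₂) (2 * a)).intHodgeClasses a) :
              rationalForms (prodObj X₁ X₂).toIsog.Φ (2 * a)) : (X₁.toIsog.E × X₂.toIsog.E) [⋀^Fin (2 * a)]→L[ℝ] ℂ), hwint⟩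
          (fundamentalCycle (prodObj X₁ X₂).toIsog.Φ (sumEnum e₁ e₂))) =
      capProduct X₂.toIsog.Φ hY ⟨(v : X₂.toIsog.E [⋀^Fin (2 * a')]→L[ℝ] ℂ), hvint⟩ (fundamentalCycle X₂.toIsog.Φ e₂) := by
    apply cycleIntegral_injective X₂.toIsog.Φ
    refine LinearMap.ext fun φ ↦ ?_
    have H : 2 * g₁ + (2 * a' + l₀) = l₀ + 2 * a := by omega
    rw [cycleIntegral_homologyMap (prodObj X₁ X₂).toIsog.Φ X₂.toIsog.Φ, realRep_sndHom, cycleIntegral_capProduct', cycleIntegral_capProduct',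
      cycleIntegral_fundamentalCycle_eq_torusIntegral, cycleIntegral_fundamentalCycle_eq_torusIntegral]
    change torusIntegral (prodPeriod X₁.toIsog.Φ X₂.toIsog.Φ) (sumEnum e₁ e₂)
        (((φ.compContinuousLinearMap (ContinuousLinearMap.snd ℝ X₁.toIsog.E X₂.toIsog.E)).wedge
          (w : (X₁.toIsog.E × X₂.toIsog.E) [⋀^Fin (2 * a)]→L[ℝ] ℂ)).domDomCongr (finCongr hX)) =
      torusIntegral X₂.toIsog.Φ e₂ ((φ.wedge (pushforwardFst X₁.toIsog.Φ X₂.toIsog.Φ e₁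
        ((w : (X₁.toIsog.E × X₂.toIsog.E) [⋀^Fin (2 * a)]→L[ℝ] ℂ).domDomCongr (finCongr haa')))).domDomCongr (finCongr hY))
    -- right-hand side: move `∫_{X₁} w` to the left and apply Fubini
    rw [wedge_comm_of_even_left₇ (pushforwardFst X₁.toIsog.Φ X₂.toIsog.Φ e₁ _) φ, domDomCongr_finCongr_domDomCongr_finCongr₇,
      torusIntegral_domDomCongr_finCongr₇, torusIntegral_domDomCongr_finCongr₇,
      torusIntegral_pushforwardFst_wedge X₁.toIsog.Φ X₂.toIsog.Φ ((finCongr H).trans ((finCongr hX).trans (sumEnum e₁ e₂))) e₁ _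
        ((w : (X₁.toIsog.E × X₂.toIsog.E) [⋀^Fin (2 * a)]→L[ℝ] ℂ).domDomCongr (finCongr haa')) φ,
      ← torusIntegral_domDomCongr_finCongr₇ _ H ((finCongr hX).trans (sumEnum e₁ e₂)), domDomCongr_finCongr_wedge₇ haa',
      domDomCongr_finCongr_domDomCongr_finCongr₇, domDomCongr_finCongr_domDomCongr_finCongr₇]
    -- left-hand side: move `w` to the left
    rw [wedge_comm_of_even_left₇ (w : (X₁.toIsog.E × X₂.toIsog.E) [⋀^Fin (2 * a)]→L[ℝ] ℂ)]
  rw [coe_integralHodgeClassesPushforward_apply, fundamentalClass_def, homologyCapMap_cyclePeriod (prodObj X₁ X₂) hX hwint, HₖIntMap_cyclePeriod, hcyc,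
    ← homologyCapMap_cyclePeriod X₂ hY hvint, ← fundamentalClass_def, poincareInverse_homologyCapMap_fundamentalClass]

end FibreIntegral

/-! ## §2 Base change along the base: `p'_{2*} ∘ (1 × f)^* = f^* ∘ p_{2*}` for ANY homomorphism `f` -/

section BaseChange

variable {X₁ X₂ X₂' : ComplexTorusCat} (f : X₂' ⟶ X₂) {g₁ n₂ n₂' g₂ g₂' G G' a a' l₀ l₀' : ℕ} (e₁ : Fin (2 * g₁) ≃ X₁.toIsog.ι)
  (e₂ : Fin n₂ ≃ X₂.toIsog.ι) (e₂' : Fin n₂' ≃ X₂'.toIsog.ι)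
  (hX : l₀ + 2 * a = 2 * g₁ + n₂) (hG : G + G = 2 * g₁ + n₂) (hY : l₀ + 2 * a' = n₂) (hg₂ : g₂ + g₂ = n₂)
  (hX' : l₀' + 2 * a = 2 * g₁ + n₂') (hG' : G' + G' = 2 * g₁ + n₂') (hY' : l₀' + 2 * a' = n₂') (hg₂' : g₂' + g₂' = n₂')

/-- **BASE CHANGE ALONG THE BASE: `p'_{2*}((1_{X₁} × f)^* w) = f^*(p_{2*} w)`** in `Hdg•(X₂′, ℤ)`, for EVERY homomorphism `f : X₂′ → X₂` of complex tori and
every `w ∈ Hdgᵃ(X₁ × X₂, ℤ)` (the square `X₁ × X₂′ → X₁ × X₂`, `X₂′ → X₂`; Birkenhake–Lange Thm. 6.2.5 "`f'_* g'^* α = g^* f_* α`", Fulton Prop. 1.7 with the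
projection proper and flat): both sides are fibre integrals (§1), and `∫_{X₁} (θ ∘ (1 × T)) = (∫_{X₁} θ) ∘ T` on forms
(`pushforwardFst_compContinuousLinearMap_id_prodMap`). Frames: concatenated on the products.
[cite: Lange2023AbelianVarietiesComplex, §6.2.1 Thm. 6.2.5 (p0302) and §6.2.2 Lemma 6.2.8 proof (p0304 L5: "Base Change Formula 6.2.5 with p₂^{12} ∘ p₁₂ = p₂^{23} ∘ p₂₃")]
[cite: Fulton1998, §1.7 Prop. 1.7 (p0030)] [cite: Arapura2012, §5.5.1 Lemma 5.5.1 (p0114)] -/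
theorem integralHodgeClassesPushforward_sndHom_pullbackHom_prodMap_id (w : integralHodgeClasses (prodObj X₁ X₂).toIsog.Φ a) :
    integralHodgeClassesPushforward a a' (sndHom X₁ X₂') (sumEnum e₁ e₂') e₂' hX' hG' hY' hg₂'
        (integralHodgeClassesPullbackHom (prodMap (𝟙 X₁) f) a w) =
      integralHodgeClassesPullbackHom f a' (integralHodgeClassesPushforward a a' (sndHom X₁ X₂) (sumEnum e₁ e₂) e₂ hX hG hY hg₂ w) := by
  have haa' : 2 * a = 2 * g₁ + 2 * a' := by omega
  refine Subtype.ext ?_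
  rw [coe_integralHodgeClassesPushforward_sndHom e₁ e₂' hX' hG' hY' hg₂' haa', coe_integralHodgeClassesPullbackHom_apply, coe_integralHodgeClassesPullbackHom_apply,
    coe_integralHodgeClassesPushforward_sndHom e₁ e₂ hX hG hY hg₂ haa', prodMap_val, id_val, realRep_fromBlocks, realRep_one,
    domDomCongr_finCongr_compContinuousLinearMap₇, pushforwardFst_compContinuousLinearMap_id_prodMap X₁.toIsog.Φ X₂.toIsog.Φ X₂'.toIsog.Φ]

end BaseChange

end ComplexTorusCat

end Literature.AlgebraicGeometry.HodgeTheory
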